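import Literature.Geometry.Riemannian.PolarGraphInjective
import Mathlib.Analysis.InnerProductSpace.Basic
import HarnessLib

/-!
# Polar-graph maps: local injectivity criterion and the differential shell lemma

Topic `Geometry/Riemannian` (elementary lemmas on inner product spaces), continuing
`PolarGraphInjective.lean` (radial growth dominates angular drift) for the interior surgery map
of Weinstein's disk (Weinstein 1968, proof of the main theorem, step (3)):

* `injOn_polarGraph_local` — the finite-difference hypotheses of `injOn_polarGraph` are only
  needed for CLOSE directions `‖u - u'‖ < 1` when, in addition, `Θ(ρ, u)` stays within `1/4` of
  `u` (far directions then have different images);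
* `eq_zero_of_polarGraph_differential` — **the differential version**: if
  `T z = (a z_r + β z_⊥) Θ + R (z_r θ_ρ + L z_⊥)` (the differential of `(ρ, u) ↦ R Θ` applied to
  `z = z_r ∂_ρ + z_⊥`, `z_⊥ ⊥ u`) with `Θ` a unit vector, `θ_ρ, L z_⊥ ⊥ Θ`, `a ≥ μ > 0`,
  `|β z_⊥| ≤ B‖z_⊥‖`, `‖θ_ρ‖ ≤ A`, `m‖z_⊥‖ ≤ ‖L z_⊥‖`, `R > 0` and `A B < μ m`, then `T z = 0`
  forces `z_r = 0` and `z_⊥ = 0` — the injectivity of the differential of the surgery map.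

## References

* A. Weinstein, Ann. of Math. (2) 87 (1968), 29–41, proof of the main theorem, step (3).
  [cite: Weinstein1968]

Tags: [PolarGraph] [Immersion] [Weinstein1968]
-/

noncomputable section

open Set Function
open scoped RealInnerProductSpace

namespace Literature.Geometry.Riemannian

variable {V : Type*} [NormedAddCommGroup V] [InnerProductSpace ℝ V]

/-- **Local shell lemma.** As `injOn_polarGraph`, but the co-Lipschitz / Lipschitz / growth
hypotheses are only assumed for directions `u, u' ∈ S` with `‖u - u'‖ < 1`, and in
exchange `‖Θ(ρ, u) - u‖ ≤ 1/4` on `J × S`: two far directions have `Θ`'s at distance `> 0`, hence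
different images. [cite: Weinstein1968, proof of the main theorem, step (3)] -/
theorem injOn_polarGraph_local {R : ℝ → V → ℝ} {Θ : ℝ → V → V} {J : Set ℝ} {S : Set V}
    {m A μ B : ℝ} (hm : 0 < m) (hB : 0 ≤ B) (hdom : A * B < μ * m)
    (hΘnorm : ∀ ρ ∈ J, ∀ u ∈ S, ‖Θ ρ u‖ = 1) (hRpos : ∀ ρ ∈ J, ∀ u ∈ S, 0 < R ρ u)
    (hΘnear : ∀ ρ ∈ J, ∀ u ∈ S, ‖Θ ρ u - u‖ ≤ 1 / 4)
    (hΘinj : ∀ ρ ∈ J, ∀ u ∈ S, ∀ u' ∈ S, ‖u - u'‖ < 1 → m * ‖u - u'‖ ≤ ‖Θ ρ u - Θ ρ u'‖)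
    (hΘρ : ∀ ρ ∈ J, ∀ ρ' ∈ J, ∀ u ∈ S, ‖Θ ρ u - Θ ρ' u‖ ≤ A * |ρ - ρ'|)
    (hR : ∀ ρ ∈ J, ∀ ρ' ∈ J, ρ ≤ ρ' → ∀ u ∈ S, ∀ u' ∈ S, ‖u - u'‖ < 1 →
      μ * (ρ' - ρ) - B * ‖u - u'‖ ≤ R ρ' u' - R ρ u) :
    InjOn (fun q : ℝ × V ↦ R q.1 q.2 • Θ q.1 q.2) (J ×ˢ S) := by
  -- equal images have equal directions
  have hdir : ∀ ρ ∈ J, ∀ ρ' ∈ J, ∀ u ∈ S, ∀ u' ∈ S,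
      R ρ u • Θ ρ u = R ρ' u' • Θ ρ' u' → Θ ρ u = Θ ρ' u' := by
    intro ρ hρ ρ' hρ' u hu u' hu' heq
    have hn : R ρ u = R ρ' u' := by
      have h := congrArg norm heq
      rw [norm_smul, norm_smul, hΘnorm ρ hρ u hu, hΘnorm ρ' hρ' u' hu', mul_one, mul_one,
        Real.norm_eq_abs, Real.norm_eq_abs, abs_of_pos (hRpos ρ hρ u hu),
        abs_of_pos (hRpos ρ' hρ' u' hu')] at h
      exact h
    rw [hn] at heq
    exact smul_right_injective V (hRpos ρ' hρ' u' hu').ne' heq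
  -- far directions have different `Θ`
  have hfar : ∀ ρ ∈ J, ∀ ρ' ∈ J, ∀ u ∈ S, ∀ u' ∈ S, 1 ≤ ‖u - u'‖ → Θ ρ u ≠ Θ ρ' u' := by
    intro ρ hρ ρ' hρ' u hu u' hu' hfar heq
    have h1 := hΘnear ρ hρ u hu
    have h2 := hΘnear ρ' hρ' u' hu'
    have h3 : ‖u - u'‖ ≤ ‖Θ ρ u - u‖ + ‖Θ ρ' u' - u'‖ := by
      have e : u - u' = (Θ ρ' u' - u') - (Θ ρ u - u) := by rw [heq]; abel
      rw [e]
      exact (norm_sub_le _ _).trans (by linarith [norm_nonneg (Θ ρ' u' - u')])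
    linarith
  -- close directions: the shell lemma on the cap `S ∩ B(u₀, 1/2)` around each point
  rintro ⟨ρ, u⟩ ⟨hρ, hu⟩ ⟨ρ', u'⟩ ⟨hρ', hu'⟩ heq
  by_cases hclose : ‖u - u'‖ < 1
  · -- restrict to `S' = {u, u'}`
    set S' : Set V := {u, u'} with hS'
    have hsub : S' ⊆ S := by
      rintro v (rfl | rfl)
      · exact hu
      · exact hu'
    have hclose' : ∀ v ∈ S', ∀ v' ∈ S', ‖v - v'‖ < 1 := by
      rintro v (rfl | rfl) v' (rfl | rfl)
      · simp
      · exact hclose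
      · rw [norm_sub_rev]; exact hclose
      · simp
    have hinj := injOn_polarGraph (R := R) (Θ := Θ) (J := J) (S := S') hm hB hdom
      (fun r hr v hv ↦ hΘnorm r hr v (hsub hv)) (fun r hr v hv ↦ hRpos r hr v (hsub hv))
      (fun r hr v hv v' hv' ↦ hΘinj r hr v (hsub hv) v' (hsub hv') (hclose' v hv v' hv'))
      (fun r hr r' hr' v hv ↦ hΘρ r hr r' hr' v (hsub hv))
      (fun r hr r' hr' hle v hv v' hv' ↦ hR r hr r' hr' hle v (hsub hv) v' (hsub hv')
        (hclose' v hv v' hv'))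
    exact hinj ⟨hρ, by simp [hS']⟩ ⟨hρ', by simp [hS']⟩ heq
  · exact absurd (hdir ρ hρ ρ' hρ' u hu u' hu' heq) (hfar ρ hρ ρ' hρ' u hu u' hu' (not_lt.1 hclose))

/-- **Differential shell lemma.** Let `Θ` be a unit vector, `θ_ρ ⊥ Θ` with `‖θ_ρ‖ ≤ A`, `w ⊥ Θ`
with `m ‖z_⊥‖ ≤ ‖w‖` (`w = L z_⊥`), scalars `a ≥ μ > 0`, `|b| ≤ B ‖z_⊥‖` (`b = β z_⊥`), `R > 0`, and
`A B < μ m`. If `(a z_r + b) Θ + R (z_r θ_ρ + w) = 0` then `z_r = 0` and `z_⊥ = 0`.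
[cite: Weinstein1968, proof of the main theorem, step (3)] -/
theorem eq_zero_of_polarGraph_differential {Θ θρ w z : V} {a b R zr m A μ B : ℝ}
    (hm : 0 < m) (hμ : 0 < μ) (hdom : A * B < μ * m)
    (hΘ : ‖Θ‖ = 1) (hθρ : ⟪Θ, θρ⟫ = 0) (hw : ⟪Θ, w⟫ = 0) (hRpos : 0 < R)
    (ha : μ ≤ a) (hb : |b| ≤ B * ‖z‖) (hθA : ‖θρ‖ ≤ A) (hwm : m * ‖z‖ ≤ ‖w‖)
    (heq : (a * zr + b) • Θ + R • (zr • θρ + w) = 0) :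
    zr = 0 ∧ z = 0 := by
  -- the `Θ`-component: `a z_r + b = 0`
  have hΘΘ : ⟪Θ, Θ⟫ = 1 := by rw [real_inner_self_eq_norm_sq, hΘ, one_pow]
  have h1 : a * zr + b = 0 := by
    have h := congrArg (fun x ↦ ⟪Θ, x⟫) heq
    simp only [inner_add_right, inner_smul_right, hΘΘ, hθρ, hw, inner_zero_right, mul_one,
      mul_zero, add_zero] at h
    linarith
  -- the orthogonal component: `R (z_r θ_ρ + w) = 0`, so `w = -z_r θ_ρ`
  have h2 : zr • θρ + w = 0 := by
    have h : R • (zr • θρ + w) = 0 := by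
      have : (a * zr + b) • Θ = 0 := by rw [h1, zero_smul]
      rw [this, zero_add] at heq
      exact heq
    exact (smul_eq_zero.1 h).resolve_left hRpos.ne'
  have hwn : ‖w‖ ≤ A * |zr| := by
    have e : w = -(zr • θρ) := eq_neg_of_add_eq_zero_right h2
    rw [e, norm_neg, norm_smul, Real.norm_eq_abs, mul_comm]
    exact mul_le_mul_of_nonneg_right hθA (abs_nonneg _)
  -- `m ‖z‖ ≤ A |z_r|` and `μ |z_r| ≤ |b| ≤ B ‖z‖`
  have h3 : m * ‖z‖ ≤ A * |zr| := hwm.trans hwn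
  have h4 : μ * |zr| ≤ B * ‖z‖ := by
    have e : |a * zr| = |b| := by
      have : a * zr = -b := by linarith
      rw [this, abs_neg]
    have ha0 : 0 < a := hμ.trans_le ha
    calc μ * |zr| ≤ a * |zr| := mul_le_mul_of_nonneg_right ha (abs_nonneg _)
      _ = |a * zr| := by rw [abs_mul, abs_of_pos ha0]
      _ = |b| := e
      _ ≤ B * ‖z‖ := hb
  -- hence `z_r = 0`
  have hzr : zr = 0 := by
    by_contra hne
    have hpos : 0 < |zr| := abs_pos.2 hne
    -- `μ m |z_r| ≤ m B ‖z‖ ≤ B A |z_r|`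
    have hB0 : 0 ≤ B := by
      by_contra hB
      rw [not_le] at hB
      have : B * ‖z‖ ≤ 0 := mul_nonpos_of_nonpos_of_nonneg hB.le (norm_nonneg _)
      have : μ * |zr| ≤ 0 := h4.trans this
      nlinarith
    have h5 : μ * m * |zr| ≤ A * B * |zr| := by
      calc μ * m * |zr| = m * (μ * |zr|) := by ring
        _ ≤ m * (B * ‖z‖) := mul_le_mul_of_nonneg_left h4 hm.le
        _ = B * (m * ‖z‖) := by ring
        _ ≤ B * (A * |zr|) := mul_le_mul_of_nonneg_left h3 hB0
        _ = A * B * |zr| := by ring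
    have h6 : μ * m ≤ A * B := le_of_mul_le_mul_right h5 hpos
    linarith
  refine ⟨hzr, ?_⟩
  have h7 : m * ‖z‖ ≤ 0 := by rw [hzr, abs_zero, mul_zero] at h3; exact h3
  have h8 : ‖z‖ ≤ 0 := by
    by_contra hne
    rw [not_le] at hne
    nlinarith
  exact norm_le_zero_iff.1 h8

end Literature.Geometry.Riemannian

end
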